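import Literature.Barriers.ResolutionOfSingularities.ResidualOrderUnboundedBlowup
import Mathlib.Algebra.CharP.Lemmas
import Mathlib.RingTheory.MvPolynomial.Basic
import HarnessLib

/-!
# Purely inseparable four-folds: the state of an ATLAS READING is forced (brick S3 (c) v4 «atlas members», first brick; cell `res-dim4-pi`)

[OURS · counted 0] (D-0157 DOOR 2; host item stmt-ResolutionOfSingularities-16155, helper). Nothing here proves resolution of
singularities in dimension ≥ 4 / characteristic `p`. typ-2's atlas package for an ESCAPING next centre
(`ChartDictionary.globalCentre_atlas_package_boundary_nearFar`) reads the transformed marked ideal on an extra chart `x_l` as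
`(z^p + F_l)·𝒪` with `F_l = g^p + τ(chartTransform F)` CLEAN for SOME polynomial `g` (the re-centring `z ↦ z + g`). This file records
that `F_l` does not depend on `g`: a clean polynomial of the form `g^p + G` IS `deletePthPowers p G` (in characteristic `p`, `g^p` has only
`p`-th power monomials, and two clean polynomials differing by a `p`-th-power-supported one are equal). Hence the readings of an atlas
member have EXPLICIT states `deletePthPowers p (τ (chartTransform p S l s.F))`, exactly like `CentreBlowup.step` on the main chart — the
format decision (d) of `res-dim4-typ-3/S3c-V4-ATLAS-MEMBERS-DESIGN.md`.

* `isQthPowerSupported_pow_char` — `g ^ p` is `p`-th-power supported in characteristic `p`.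
* `eq_deletePthPowers_of_isClean_pow_add` — `IsClean p (g^p + G) → g^p + G = deletePthPowers p G`.
* `eq_of_isClean_of_isQthPowerSupported_sub` — two clean polynomials with `p`-th-power supported difference are equal.
* `deletePthPowers_pow_add` / `deletePthPowers_add_pow` — cleaning ignores an added `p`-th power.

AI-produced formalisation, weaker than expert review. bears_on: LADDER-RESOLUTION:D157-DOOR2 (res-dim4-pi · S3 (c) v4 atlas members).
-/

set_option linter.dupNamespace false -- D-0017: single-problem summit path `Summit.<S>.<S>.…` by design

noncomputable section

open MvPolynomial

namespace Summit.ResolutionOfSingularities.ResolutionOfSingularities.Theorems.PIDim4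

open Literature.AlgebraicGeometry.Resolution.Hauser2010
open Literature.Barriers.ResolutionOfSingularities.HauserPerlega

namespace Equimultiple

section AtlasReadingState

variable {σ : Type*} [DecidableEq σ] {K : Type*} [CommRing K] (p : ℕ) [hp : Fact p.Prime] [CharP K p]

/-- In characteristic `p`, every monomial of `g^p` is a `p`-th power monomial. [folklore] -/
theorem isQthPowerSupported_pow_char (g : MvPolynomial σ K) : IsQthPowerSupported p (g ^ p) := by
  induction g using MvPolynomial.induction_on with
  | C a => rw [← C_pow]; exact isQthPowerSupported_C p _
  | add P Q hP hQ => rw [add_pow_char P Q]; exact hP.add hQ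
  | mul_X P i hP => rw [mul_pow]; exact hP.mul (isQthPowerSupported_X_pow p i)

omit hp [CharP K p] in
/-- **Two clean polynomials with `p`-th-power supported difference are equal.** [cite: HauserPerlega2019PRIMS, §2 (cleaning)] -/
theorem eq_of_isClean_of_isQthPowerSupported_sub {F F' : MvPolynomial σ K} (hF : IsClean p F) (hF' : IsClean p F')
    (h : IsQthPowerSupported p (F - F')) : F = F' := by
  have h1 : deletePthPowers p (F - F') = 0 := h.deletePthPowers_eq_zero
  have h2 : deletePthPowers p (F - F') + deletePthPowers p F' = deletePthPowers p F := by
    rw [← deletePthPowers_add, sub_add_cancel]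
  rw [h1, zero_add, deletePthPowers_eq_self hF, deletePthPowers_eq_self hF'] at h2
  exact h2.symm

/-- **The state of an atlas reading is forced**: a CLEAN polynomial of the form `g^p + G` is `deletePthPowers p G` — the re-centring
polynomial `g` of typ-2's extra-chart reading is invisible in the state. [cite: HauserPerlega2019PRIMS, §2 (cleaning)] -/
theorem eq_deletePthPowers_of_isClean_pow_add (g G : MvPolynomial σ K) (h : IsClean p (g ^ p + G)) :
    g ^ p + G = deletePthPowers p G := by
  rw [← deletePthPowers_eq_self h, deletePthPowers_add, (isQthPowerSupported_pow_char p g).deletePthPowers_eq_zero, zero_add]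

/-- The same with the summands commuted (`G + g^p`). [folklore] -/
theorem eq_deletePthPowers_of_isClean_add_pow (g G : MvPolynomial σ K) (h : IsClean p (G + g ^ p)) :
    G + g ^ p = deletePthPowers p G := by
  rw [add_comm] at h ⊢
  exact eq_deletePthPowers_of_isClean_pow_add p g G h

/-- Cleaning ignores an added `p`-th power: `deletePthPowers p (g^p + G) = deletePthPowers p G`. [cite: HauserPerlega2019PRIMS, §2 (cleaning)] -/
theorem deletePthPowers_pow_add (g G : MvPolynomial σ K) : deletePthPowers p (g ^ p + G) = deletePthPowers p G := by
  rw [deletePthPowers_add, (isQthPowerSupported_pow_char p g).deletePthPowers_eq_zero, zero_add]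

/-- Cleaning ignores an added `p`-th power (summands commuted). [folklore] -/
theorem deletePthPowers_add_pow (g G : MvPolynomial σ K) : deletePthPowers p (G + g ^ p) = deletePthPowers p G := by
  rw [add_comm, deletePthPowers_pow_add]

end AtlasReadingState

end Equimultiple

end Summit.ResolutionOfSingularities.ResolutionOfSingularities.Theorems.PIDim4

end
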